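import Mathlib
import Summits.ResolutionOfSingularities.ResolutionOfSingularities.Theorems.WeightedInvariantLocalWeightedDropTOT2CurveRootsFinite
import Summits.ResolutionOfSingularities.ResolutionOfSingularities.Theorems.WeightedInvariantLocalWeightedDropMonicDescentShearRecentre
import Summits.ResolutionOfSingularities.ResolutionOfSingularities.Theorems.WeightedInvariantLocalWeightedDropMonicDescentTailPointStep
import Summits.ResolutionOfSingularities.ResolutionOfSingularities.Theorems.WeightedInvariantLocalWeightedDropPolyDescentSelDefs

/-!
# `LocalWeightedDrop`, TOT2-LINE regime (P), piece (B1b-insep) — TOOLS: slot `0` of a re-centred sheared label, Frobenius on exponents,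
# splitting a series by one exponent modulo `p`, shears of series with divisible exponents, uniqueness of `u₂`-rows / `u₁ mod p`-parts

Crux item stmt-ResolutionOfSingularities-8899 `WeightedInvariant.LocalWeightedDrop` (route `ResolutionOfSingularities/WeightedInvariant`), ENGINE
skeleton v33 (35b29332b4d99231), registered stub `stub_regimePresented`; TOT2-LINE v1.3 §3 (P3)/(B1) (`L/res-L1-w43-lead-1/g5/TOT2-LINE-v1.3.md`),
NAMING res-L1-w43-lead-1 2026-08-27T16:23:53Z.  [OURS · L1 W4.3 · chain w43 · seat res-L1-w43-stub-1 gen 6; def-free; the elementary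
power-series algebra in characteristic `p` (Frobenius through `MvPowerSeries.expand` / `map_iterateFrobenius_expand`) behind the `h`-independent
branch witness `…TOT2CurveBranchWitnessInsep`; vocabulary: res-type-088's `u₂`-free part `subst ![X 0, 0]` (…TOT2CurveConflictShift/DivTwo), the
shear `MonicDescent.shear h : u₂ ↦ u₂ + u₁h`, `WildMonic.shift` (re-centring `y ↦ y + ψ`), `PolyDescent.IsPermissibleTwoT`; nothing here is a
statement of any manuscript; AI-produced, gate-checked, weaker than expert review.]

* `shift_shearT_zero`, `coeff_slot_zero_eq_zero` — slot `0` of the re-centred shear of a label concentrated in slot `0` is `ψ^d + A₀(u₁,u₂+u₁h)`;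
  `V(y,u₂)`-permissibility kills its coefficients of `u₂`-degree `< d`; `false_of_constantCoeff_ne_zero` — so `A₀(0) = 0`.
* `coeff_pow_prime_pow_eq_zero` — `F^{p^n}` only has exponents in `p^n·ℕ^σ`.
* `eq_sum_X_pow_mul_modPart` (+ `modPart_ne_zero`, `dvd_of_coeff_modPart_ne_zero(_self)`, `exists_modPart`) — `F = Σ_{t<p} X_i^t·C_t` by `e_i mod p`.
* `coeff_shear_eq_zero_of_dvd_one` / `_both` — `C(u₁,u₂+u₁h)` has no monomial with `0 < e₂ < p` if `p ∣` all `e₂` of `C`; no monomial with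
  `p ∤ e₁` if `p ∣` all exponents of `C` (`(u₂+u₁h)^{pb} = ((u₂+u₁h)^b)^p`).
* `eq_zero_of_sum_X_one_pow_mul`, `eq_zero_of_sum_X_zero_pow_mul` — uniqueness of `u₂`-rows, resp. of the `e₁ mod p` splitting inside `k⟦u₁^p⟧`-like
  parts; `shear_injective_of_noY`; `exists_pow_eq_of_dvd` — over a perfect field a series with all exponents divisible by `p` is a `p`-th power.
-/

set_option linter.dupNamespace false -- mandated namespace of this single-conjunct summit

noncomputable section

namespace Summit.ResolutionOfSingularities.ResolutionOfSingularities.Theorems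

namespace TOT2Curve

open MvPowerSeries PolyDescent MonicDescent WildMonic Literature.AlgebraicGeometry.Resolution

variable {k : Type} [Field k]

/-! ## Slot `0` of the re-centred sheared label -/

/-- Evaluation of the monic polynomial of a tuple: `(Y^d + Σ A_j Y^j)(φ) = φ^d + Σ A_j φ^j`. -/
theorem eval_monicPoly {R : Type*} [CommRing R] (d : ℕ) (A : Fin d → R) (φ : R) :
    (monicPoly d A).eval φ = φ ^ d + ∑ j : Fin d, A j * φ ^ (j : ℕ) := by
  simp only [monicPoly, Polynomial.eval_add, Polynomial.eval_pow, Polynomial.eval_X, Polynomial.eval_finsetSum,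
    Polynomial.eval_mul, Polynomial.eval_C]

/-- Slot `0` of the re-centred tuple is the value of the monic polynomial at the re-centring. -/
theorem shift_zero_eq {R : Type*} [CommRing R] {d : ℕ} (hd : 0 < d) (A : Fin d → R) (φ : R) :
    shift d A φ ⟨0, hd⟩ = φ ^ d + ∑ j : Fin d, A j * φ ^ (j : ℕ) := by
  show (Polynomial.taylor φ (monicPoly d A)).coeff 0 = _
  rw [Polynomial.taylor_coeff_zero, eval_monicPoly]

/-- The shear is additive over finite sums. -/
theorem shear_finset_sum {ι : Type*} (h : MvPowerSeries (Fin 2) k) (s : Finset ι) (F : ι → MvPowerSeries (Fin 2) k) :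
    shear h (∑ i ∈ s, F i) = ∑ i ∈ s, shear h (F i) := by
  simp only [shear_eq, ← substAlgHom_apply (hasSubst_of_constantCoeff_zero (constantCoeff_shearFamily h)), map_sum]

/-- Slot `0` of the re-centred shear of a label concentrated in slot `0`: `ψ^d + A₀(u₁, u₂ + u₁h)`. -/
theorem shift_shearT_zero {d : ℕ} (hd : 0 < d) (A : Fin d → MvPowerSeries (Fin 2) k) (hA : ∀ i : Fin d, (i : ℕ) ≠ 0 → A i = 0)
    (h ψ : MvPowerSeries (Fin 2) k) : shift d (shearT h A) ψ ⟨0, hd⟩ = ψ ^ d + shear h (A ⟨0, hd⟩) := by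
  rw [shift_zero_eq, Finset.sum_eq_single ⟨0, hd⟩]
  · rw [shearT, pow_zero, mul_one]
  · intro j _ hj
    rw [shearT, hA j (fun h0 => hj (Fin.ext h0)), shear_zero_right, zero_mul]
  · intro h0
    exact absurd (Finset.mem_univ _) h0

/-- `V(y,u₂)`-permissibility of the re-centred shear forces every coefficient of `ψ^d + A₀(u₁,u₂+u₁h)` of `u₂`-degree `< d`
to vanish. -/
theorem coeff_slot_zero_eq_zero {d : ℕ} (hd : 0 < d) {A : Fin d → MvPowerSeries (Fin 2) k} (hA : ∀ i : Fin d, (i : ℕ) ≠ 0 → A i = 0)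
    {h ψ : MvPowerSeries (Fin 2) k} (hperm : IsPermissibleTwoT d (shift d (shearT h A) ψ)) {e : Fin 2 →₀ ℕ} (he : e 1 < d) :
    coeff e (ψ ^ d + shear h (A ⟨0, hd⟩)) = 0 := by
  by_contra hne
  have h1 := hperm ⟨0, hd⟩ e (by rwa [shift_shearT_zero hd A hA])
  simp only [Nat.sub_zero] at h1
  omega

/-- The shear keeps the constant term. -/
theorem constantCoeff_shear_eq (h A : MvPowerSeries (Fin 2) k) : constantCoeff (shear h A) = constantCoeff A := by
  obtain ⟨R, hR⟩ := X_dvd_shear_sub h A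
  have h1 : shear h A = A + X 0 * R := by rw [← hR]; ring
  rw [h1, map_add, map_mul, constantCoeff_X, zero_mul, add_zero]

/-- If `A₀(0) ≠ 0`, no graph datum qualifies: the constant term of slot `0` is `A₀(0)`. -/
theorem false_of_constantCoeff_ne_zero {d : ℕ} (hd : 0 < d) {A : Fin d → MvPowerSeries (Fin 2) k} (hA : ∀ i : Fin d, (i : ℕ) ≠ 0 → A i = 0)
    (hc : constantCoeff (A ⟨0, hd⟩) ≠ 0) {h ψ : MvPowerSeries (Fin 2) k} (hψ : constantCoeff ψ = 0)
    (hperm : IsPermissibleTwoT d (shift d (shearT h A) ψ)) : False := by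
  have h0 := coeff_slot_zero_eq_zero hd hA hperm (e := 0) (by rw [Finsupp.zero_apply]; exact hd)
  rw [coeff_zero_eq_constantCoeff_apply, map_add, map_pow, hψ, zero_pow (Nat.pos_iff_ne_zero.mp hd), zero_add,
    constantCoeff_shear_eq] at h0
  exact hc h0

/-! ## Frobenius: exponents of `p^n`-th powers -/

/-- In characteristic `p`, a `p^n`-th power has no monomial with an exponent not divisible by `p^n`. -/
theorem coeff_pow_prime_pow_eq_zero (p : ℕ) [Fact p.Prime] [CharP k p] {σ : Type*} (F : MvPowerSeries σ k) (n : ℕ)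
    {e : σ →₀ ℕ} {i : σ} (h : ¬ p ^ n ∣ e i) : coeff e (F ^ p ^ n) = 0 := by
  rw [← map_iterateFrobenius_expand p (Nat.Prime.ne_zero Fact.out) F n, coeff_map, coeff_expand_of_not_dvd (p ^ n) _ F h, map_zero]

/-- In characteristic `p`, a `p`-th power has no monomial with an exponent not divisible by `p`. -/
theorem coeff_pow_prime_eq_zero (p : ℕ) [Fact p.Prime] [CharP k p] {σ : Type*} (F : MvPowerSeries σ k)
    {e : σ →₀ ℕ} {i : σ} (h : ¬ p ∣ e i) : coeff e (F ^ p) = 0 := by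
  have h1 := coeff_pow_prime_pow_eq_zero p F 1 (e := e) (i := i) (by rwa [pow_one])
  rwa [pow_one] at h1

/-! ## Coefficient tools -/

/-- Coefficients of `X_i^s · G`. -/
theorem coeff_X_pow_mul_eq (i : Fin 2) (s : ℕ) (G : MvPowerSeries (Fin 2) k) (m : Fin 2 →₀ ℕ) :
    coeff m (X i ^ s * G) = if s ≤ m i then coeff (m - Finsupp.single i s) G else 0 := by
  rw [X_pow_eq, coeff_monomial_mul, one_mul]
  simp only [Finsupp.single_le_iff]

/-- A series fixed by the `u₂`-free part map has no monomial involving `u₂`. -/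
theorem coeff_eq_zero_of_killTwo_eq {F : MvPowerSeries (Fin 2) k} (hF : subst (![X 0, 0] : Fin 2 → MvPowerSeries (Fin 2) k) F = F)
    {m : Fin 2 →₀ ℕ} (hm : m 1 ≠ 0) : coeff m F = 0 := by
  rw [← hF, coeff_subst_killTwo, if_neg hm]

/-- The `u₂`-free part has no monomial involving `u₂`. -/
theorem coeff_killTwo_of_ne_zero (F : MvPowerSeries (Fin 2) k) {m : Fin 2 →₀ ℕ} (hm : m 1 ≠ 0) :
    coeff m (subst (![X 0, 0] : Fin 2 → MvPowerSeries (Fin 2) k) F) = 0 := by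
  rw [coeff_subst_killTwo, if_neg hm]

/-- `u₂^t · E` with `E` `u₂`-free lives in `u₂`-degree exactly `t`. -/
theorem coeff_X_one_pow_mul_of_noY (t : ℕ) {E : MvPowerSeries (Fin 2) k} (hE : ∀ m : Fin 2 →₀ ℕ, m 1 ≠ 0 → coeff m E = 0)
    (m : Fin 2 →₀ ℕ) : coeff m (X 1 ^ t * E) = if m 1 = t then coeff (m - Finsupp.single 1 t) E else 0 := by
  rw [coeff_X_pow_mul_eq]
  by_cases ht : m 1 = t
  · rw [if_pos ht.symm.le, if_pos ht]
  · rw [if_neg ht]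
    split_ifs with hle
    · apply hE
      simp only [Finsupp.coe_tsub, Pi.sub_apply, Finsupp.single_eq_same]
      omega
    · rfl

/-- `u₁^s · E` with `E` `u₂`-free: coefficients. -/
theorem coeff_X_zero_pow_mul_eq (s : ℕ) (E : MvPowerSeries (Fin 2) k) (m : Fin 2 →₀ ℕ) :
    coeff m (X 0 ^ s * E) = if s ≤ m 0 then coeff (m - Finsupp.single 0 s) E else 0 :=
  coeff_X_pow_mul_eq 0 s E m

/-- The part `(u₂ + u₁h)^t · E`, `E` and `h` `u₂`-free, has `u₂`-degree `≤ t`. -/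
theorem coeff_shearX_pow_mul_eq_zero {h E : MvPowerSeries (Fin 2) k} (hh : ∀ m : Fin 2 →₀ ℕ, m 1 ≠ 0 → coeff m h = 0)
    (hE : ∀ m : Fin 2 →₀ ℕ, m 1 ≠ 0 → coeff m E = 0) {t : ℕ} {m : Fin 2 →₀ ℕ} (htm : t < m 1) :
    coeff m ((X 1 + X 0 * h) ^ t * E) = 0 := by
  rw [add_pow, Finset.sum_mul, map_sum, Finset.sum_eq_zero]
  intro j hj
  have hj' : j ≤ t := Nat.lt_succ_iff.mp (Finset.mem_range.mp hj)
  have h1 : X 1 ^ j * (X 0 * h) ^ (t - j) * (t.choose j : MvPowerSeries (Fin 2) k) * E =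
      X 1 ^ j * ((X 0 * h) ^ (t - j) * (t.choose j : MvPowerSeries (Fin 2) k) * E) := by ring
  rw [h1, coeff_X_one_pow_mul_of_noY j, if_neg (by omega)]
  intro m' hm'
  have hfix : subst (![X 0, 0] : Fin 2 → MvPowerSeries (Fin 2) k) ((X 0 * h) ^ (t - j) * (t.choose j : MvPowerSeries (Fin 2) k) * E) =
      (X 0 * h) ^ (t - j) * (t.choose j : MvPowerSeries (Fin 2) k) * E := by
    rw [← substAlgHom_apply hasSubst_killTwo, map_mul, map_mul, map_pow, map_mul, map_natCast, substAlgHom_apply,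
      substAlgHom_apply, substAlgHom_apply, subst_X hasSubst_killTwo, killTwo_of_noY h hh, killTwo_of_noY E hE]
    rfl
  exact coeff_eq_zero_of_killTwo_eq hfix hm'

/-! ## Splitting a series by the residue of one exponent modulo `p` -/

/-- THE `mod p` SPLITTING along the letter `i`: `F = Σ_{t<p} X_i^t · C_t` where `C_t` collects the monomials of `F` with `e_i ≡ t (mod p)`,
divided by `X_i^t` (given here by its coefficients `hC`). -/
theorem eq_sum_X_pow_mul_modPart {p : ℕ} (hp : 0 < p) (i : Fin 2) (F : MvPowerSeries (Fin 2) k) (C : ℕ → MvPowerSeries (Fin 2) k)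
    (hC : ∀ t (e : Fin 2 →₀ ℕ), coeff e (C t) = if p ∣ e i then coeff (e + Finsupp.single i t) F else 0) :
    F = ∑ t ∈ Finset.range p, X i ^ t * C t := by
  ext m
  rw [map_sum, Finset.sum_eq_single (m i % p)]
  · rw [coeff_X_pow_mul_eq, if_pos (Nat.mod_le _ _), hC, if_pos, tsub_add_cancel_of_le (Finsupp.single_le_iff.mpr (Nat.mod_le _ _))]
    simp only [Finsupp.coe_tsub, Pi.sub_apply, Finsupp.single_eq_same]
    exact Nat.dvd_sub_mod (m i)
  · intro t ht hne
    rw [coeff_X_pow_mul_eq]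
    split_ifs with hle
    · rw [hC, if_neg]
      intro hdvd
      apply hne
      simp only [Finsupp.coe_tsub, Pi.sub_apply, Finsupp.single_eq_same] at hdvd
      obtain ⟨c, hc⟩ := hdvd
      have hmi : m i = p * c + t := by omega
      rw [hmi, Nat.mul_add_mod, Nat.mod_eq_of_lt (Finset.mem_range.mp ht)]
    · rfl
  · intro hnot
    exact absurd (Finset.mem_range.mpr (Nat.mod_lt _ hp)) hnot

/-- The `t`-th part is non-zero as soon as `F` has a monomial with `e_i ≡ t (mod p)`. -/
theorem modPart_ne_zero {p : ℕ} (i : Fin 2) (F : MvPowerSeries (Fin 2) k) (C : ℕ → MvPowerSeries (Fin 2) k)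
    (hC : ∀ t (e : Fin 2 →₀ ℕ), coeff e (C t) = if p ∣ e i then coeff (e + Finsupp.single i t) F else 0)
    {e : Fin 2 →₀ ℕ} (he : coeff e F ≠ 0) : C (e i % p) ≠ 0 := by
  intro h0
  have h1 := hC (e i % p) (e - Finsupp.single i (e i % p))
  rw [h0, map_zero, if_pos, tsub_add_cancel_of_le (Finsupp.single_le_iff.mpr (Nat.mod_le _ _))] at h1
  · exact he h1.symm
  · simp only [Finsupp.coe_tsub, Pi.sub_apply, Finsupp.single_eq_same]
    exact Nat.dvd_sub_mod (e i)

/-- The parts inherit divisibility of the OTHER exponent. -/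
theorem dvd_of_coeff_modPart_ne_zero {p : ℕ} (i j : Fin 2) (hij : j ≠ i) (F : MvPowerSeries (Fin 2) k) (C : ℕ → MvPowerSeries (Fin 2) k)
    (hC : ∀ t (e : Fin 2 →₀ ℕ), coeff e (C t) = if p ∣ e i then coeff (e + Finsupp.single i t) F else 0)
    (hF : ∀ e : Fin 2 →₀ ℕ, coeff e F ≠ 0 → p ∣ e j) {t : ℕ} {e : Fin 2 →₀ ℕ} (he : coeff e (C t) ≠ 0) : p ∣ e j := by
  rw [hC] at he
  split_ifs at he with hdvd
  · have h1 := hF _ he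
    rwa [Finsupp.add_apply, Finsupp.single_eq_of_ne hij, add_zero] at h1
  · exact absurd rfl he

/-- The parts have `p ∣ e_i` on every monomial. -/
theorem dvd_of_coeff_modPart_ne_zero_self {p : ℕ} (i : Fin 2) (F : MvPowerSeries (Fin 2) k) (C : ℕ → MvPowerSeries (Fin 2) k)
    (hC : ∀ t (e : Fin 2 →₀ ℕ), coeff e (C t) = if p ∣ e i then coeff (e + Finsupp.single i t) F else 0)
    {t : ℕ} {e : Fin 2 →₀ ℕ} (he : coeff e (C t) ≠ 0) : p ∣ e i := by
  rw [hC] at he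
  split_ifs at he with hdvd
  · exact hdvd
  · exact absurd rfl he

/-- The parts exist (as functions on exponents). -/
theorem exists_modPart (p : ℕ) (i : Fin 2) (F : MvPowerSeries (Fin 2) k) : ∃ C : ℕ → MvPowerSeries (Fin 2) k,
    ∀ t (e : Fin 2 →₀ ℕ), coeff e (C t) = if p ∣ e i then coeff (e + Finsupp.single i t) F else 0 := by
  classical
  exact ⟨fun t => show MvPowerSeries (Fin 2) k from fun e => if p ∣ e i then coeff (e + Finsupp.single i t) F else 0,
    fun t e => rfl⟩

/-! ## The shear of a series with divisible exponents -/

/-- The substitution family of the shear as a product over `Fin 2`. -/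
theorem prod_shearFamily_pow (h : MvPowerSeries (Fin 2) k) (d : Fin 2 →₀ ℕ) :
    (d.prod fun s e => ((![X 0, X 1 + X 0 * h] : Fin 2 → MvPowerSeries (Fin 2) k) s) ^ e) = X 0 ^ d 0 * (X 1 + X 0 * h) ^ d 1 := by
  rw [Finsupp.prod_fintype _ _ (fun i => pow_zero _), Fin.prod_univ_two]
  rfl

/-- CASE (a) TOOL.  If every `u₂`-exponent of `C` is divisible by `p`, then `C(u₁, u₂ + u₁h)` (`h` arbitrary) has no monomial with
`0 < e₂ < p`: `u₁^{a}(u₂ + u₁h)^{pb} = u₁^a · ((u₂+u₁h)^b)^p`. -/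
theorem coeff_shear_eq_zero_of_dvd_one (p : ℕ) [Fact p.Prime] [CharP k p] {C : MvPowerSeries (Fin 2) k} (h : MvPowerSeries (Fin 2) k)
    (hC : ∀ e : Fin 2 →₀ ℕ, coeff e C ≠ 0 → p ∣ e 1) {m : Fin 2 →₀ ℕ} (hm0 : m 1 ≠ 0) (hmp : m 1 < p) :
    coeff m (shear h C) = 0 := by
  rw [shear_eq, coeff_subst (hasSubst_of_constantCoeff_zero (constantCoeff_shearFamily h)), finsum_eq_zero_of_forall_eq_zero]
  intro d
  by_cases hd : coeff d C = 0
  · rw [hd, zero_smul]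
  obtain ⟨b, hb⟩ := hC d hd
  rw [prod_shearFamily_pow, hb, pow_mul', coeff_X_zero_pow_mul_eq]
  split_ifs with hle
  · rw [coeff_pow_prime_eq_zero p _ (i := 1), smul_zero]
    simp only [Finsupp.coe_tsub, Pi.sub_apply, Finsupp.single_eq_of_ne (show (1 : Fin 2) ≠ 0 from by decide), tsub_zero]
    exact Nat.not_dvd_of_pos_of_lt (Nat.pos_of_ne_zero hm0) hmp
  · rw [smul_zero]

/-- CASE (b) TOOL.  If every exponent of `D` (both letters) is divisible by `p`, then `D(u₁, u₂ + u₁h)` has no monomial with `p ∤ e₁`: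
`u₁^{pa}(u₂+u₁h)^{pb} = (u₁^a (u₂+u₁h)^b)^p`. -/
theorem coeff_shear_eq_zero_of_dvd_both (p : ℕ) [Fact p.Prime] [CharP k p] {D : MvPowerSeries (Fin 2) k} (h : MvPowerSeries (Fin 2) k)
    (hD : ∀ e : Fin 2 →₀ ℕ, coeff e D ≠ 0 → p ∣ e 0 ∧ p ∣ e 1) {m : Fin 2 →₀ ℕ} (hm : ¬ p ∣ m 0) :
    coeff m (shear h D) = 0 := by
  rw [shear_eq, coeff_subst (hasSubst_of_constantCoeff_zero (constantCoeff_shearFamily h)), finsum_eq_zero_of_forall_eq_zero]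
  intro d
  by_cases hd : coeff d D = 0
  · rw [hd, zero_smul]
  obtain ⟨⟨a, ha⟩, ⟨b, hb⟩⟩ := hD d hd
  rw [prod_shearFamily_pow, ha, hb, pow_mul', pow_mul', ← mul_pow, coeff_pow_prime_eq_zero p _ (i := 0) hm, smul_zero]

/-! ## Uniqueness of `u₂`-rows; injectivity of the shear -/

/-- UNIQUENESS OF THE `u₂`-ADIC ROWS: if `E' + Σ_{t<p} u₂^t E_t = 0` with all `E'`, `E_t` `u₂`-free, then `E_t = 0` for `1 ≤ t < p`. -/
theorem eq_zero_of_sum_X_one_pow_mul {p : ℕ} {E' : MvPowerSeries (Fin 2) k} {E : ℕ → MvPowerSeries (Fin 2) k}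
    (hE' : ∀ m : Fin 2 →₀ ℕ, m 1 ≠ 0 → coeff m E' = 0) (hE : ∀ t (m : Fin 2 →₀ ℕ), m 1 ≠ 0 → coeff m (E t) = 0)
    (hsum : E' + ∑ t ∈ Finset.range p, X 1 ^ t * E t = 0) {t : ℕ} (ht1 : 1 ≤ t) (htp : t < p) : E t = 0 := by
  ext m
  rw [map_zero]
  by_cases hm : m 1 ≠ 0
  · exact hE t m hm
  push Not at hm
  have h1 := congrArg (coeff (m + Finsupp.single 1 t)) hsum
  rw [map_add, map_zero, hE' _ (by simp only [Finsupp.add_apply, Finsupp.single_eq_same]; omega), zero_add, map_sum,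
    Finset.sum_eq_single t] at h1
  · rwa [coeff_X_one_pow_mul_of_noY t (hE t), if_pos (by simp only [Finsupp.add_apply, Finsupp.single_eq_same]; omega),
      add_tsub_cancel_right] at h1
  · intro s _ hs
    rw [coeff_X_one_pow_mul_of_noY s (hE s), if_neg]
    simp only [Finsupp.add_apply, Finsupp.single_eq_same]
    omega
  · intro hnot
    exact absurd (Finset.mem_range.mpr htp) hnot

/-- The shear is injective on series (its inverse is the shear by `−h`). -/
theorem shear_injective_of_noY {h : MvPowerSeries (Fin 2) k} (hh : ∀ m : Fin 2 →₀ ℕ, m 1 ≠ 0 → coeff m h = 0)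
    {F : MvPowerSeries (Fin 2) k} (hF : shear h F = 0) : F = 0 := by
  have h1 : shear (-h) (shear h F) = F := by
    rw [shear_shear_of_noY (-h) h F hh, neg_add_cancel, shear_zero_eq]
  rw [← h1, hF, shear_zero_right]

/-! ## Uniqueness of the `e₁ mod p` splitting -/

/-- UNIQUENESS OF THE SPLITTING BY `e₁ mod p`: if `Σ_{s<p} u₁^s E_s = R` where every `E_s` and `R` only have monomials with `p ∣ e₁`,
then `E_s = 0` for `1 ≤ s < p`. -/
theorem eq_zero_of_sum_X_zero_pow_mul {p : ℕ} {R : MvPowerSeries (Fin 2) k} {E : ℕ → MvPowerSeries (Fin 2) k}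
    (hR : ∀ m : Fin 2 →₀ ℕ, ¬ p ∣ m 0 → coeff m R = 0) (hE : ∀ s (m : Fin 2 →₀ ℕ), ¬ p ∣ m 0 → coeff m (E s) = 0)
    (hsum : ∑ s ∈ Finset.range p, X 0 ^ s * E s = R) {s : ℕ} (hs1 : 1 ≤ s) (hsp : s < p) : E s = 0 := by
  ext m
  rw [map_zero]
  by_cases hm : ¬ p ∣ m 0
  · exact hE s m hm
  push Not at hm
  have hns : ¬ p ∣ m 0 + s := by
    intro h1
    have h2 := (Nat.dvd_add_right hm).mp h1
    exact absurd (Nat.le_of_dvd hs1 h2) (not_le.mpr hsp)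
  have h1 := congrArg (coeff (m + Finsupp.single 0 s)) hsum
  rw [hR _ (by simpa only [Finsupp.add_apply, Finsupp.single_eq_same] using hns), map_sum, Finset.sum_eq_single s] at h1
  · rwa [coeff_X_zero_pow_mul_eq, if_pos (by simp only [Finsupp.add_apply, Finsupp.single_eq_same]; omega),
      add_tsub_cancel_right] at h1
  · intro s' hs' hne
    rw [coeff_X_zero_pow_mul_eq]
    split_ifs with hle
    · apply hE s'
      simp only [Finsupp.coe_tsub, Finsupp.coe_add, Pi.sub_apply, Pi.add_apply, Finsupp.single_eq_same]
      simp only [Finsupp.add_apply, Finsupp.single_eq_same] at hle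
      intro h2
      apply hne
      -- `p ∣ m 0`, `p ∣ m 0 + s - s'`, `s' ≤ m 0 + s`, `s, s' < p` ⇒ `s' = s`
      have h3 : s' ≡ m 0 + s [MOD p] := (Nat.modEq_iff_dvd' hle).mpr h2
      have h4 : m 0 + s ≡ 0 + s [MOD p] := Nat.ModEq.add_right s ((Nat.modEq_zero_iff_dvd).mpr hm)
      have h5 := (h3.trans h4)
      rw [zero_add] at h5
      have h6 : s' % p = s % p := h5
      rwa [Nat.mod_eq_of_lt (Finset.mem_range.mp hs'), Nat.mod_eq_of_lt hsp] at h6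
    · rfl
  · intro hnot
    exact absurd (Finset.mem_range.mpr hsp) hnot

/-! ## `p`-th powers over a perfect field -/

/-- A series all of whose exponents are divisible by `p` is a `p`-th power over a perfect field. -/
theorem exists_pow_eq_of_dvd (p : ℕ) [Fact p.Prime] [CharP k p] [PerfectRing k p] {σ : Type*} (F : MvPowerSeries σ k)
    (hF : ∀ e : σ →₀ ℕ, coeff e F ≠ 0 → ∀ i, p ∣ e i) : ∃ G : MvPowerSeries σ k, G ^ p = F ∧ constantCoeff G ^ p = constantCoeff F := by
  have hp : p ≠ 0 := Nat.Prime.ne_zero Fact.out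
  classical
  -- `F = expand p F'`
  set F' : MvPowerSeries σ k := show MvPowerSeries σ k from fun m => coeff (p • m) F with hF'def
  have hF' : ∀ m : σ →₀ ℕ, coeff m F' = coeff (p • m) F := fun m => rfl
  have hexp : expand p hp F' = F := by
    ext m
    by_cases hm : ∀ i, p ∣ m i
    · choose c hc using hm
      have hm' : m = p • (show σ →₀ ℕ from Finsupp.mapRange (fun x => x / p) (Nat.zero_div p) m) := by
        ext i
        simp only [Finsupp.coe_smul, Finsupp.mapRange_apply, Pi.smul_apply, smul_eq_mul]
        rw [hc i, Nat.mul_div_cancel_left _ (Nat.pos_of_ne_zero hp)]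
      rw [hm', coeff_expand_smul, hF', ← hm']
    · push Not at hm
      obtain ⟨i, hi⟩ := hm
      rw [coeff_expand_of_not_dvd p hp F' hi]
      by_contra hne
      exact hi (hF m (Ne.symm hne) i)
  refine ⟨map ((frobeniusEquiv k p).symm : k →+* k) F', ?_, ?_⟩
  · rw [← map_frobenius_expand p hp, map_expand, ← hexp]
    congr 1
    ext m
    simp only [coeff_map, RingHom.coe_coe, frobenius_def]
    exact (frobeniusEquiv k p).apply_symm_apply _
  · rw [constantCoeff_map, RingHom.coe_coe, ← frobenius_def, ← coe_frobeniusEquiv]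
    rw [RingEquiv.apply_symm_apply, ← hexp, constantCoeff_expand]

end TOT2Curve

end Summit.ResolutionOfSingularities.ResolutionOfSingularities.Theorems

end
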